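import Summits.ValiantsHypothesis.ValiantsHypothesis.Theorems.AnyonJetsJetConstantElimDefs
import Summits.ValiantsHypothesis.ValiantsHypothesis.Theorems.AnyonJetsJetConstantElimSignSimulation
import Literature.Computability.AlgebraicComplexity.ConstantFreeNumerals
import Mathlib.FieldTheory.IsAlgClosed.AlgebraicClosure
import Mathlib.Analysis.Complex.Polynomial.Basic
import Mathlib.NumberTheory.Padics.PadicVal.Basic
import HarnessLib

/-!
# AnyonJets — crux `JetConstantElimTwoAdic` (stmt-ValiantsHypothesis-23655), stub
# `∃ b₁, IntegralMultipleTwoAdicWith b₁`: calibration (the stub is the crux; the `Q`-free road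
# refutes the partner binder `CF^ult`)

Route-independent (imports only the `Defs` vocabulary of the bypass and the landed sign
simulation; no `Theses` import, no definitions, no `sorry`). Companion of
`…IntegralMultipleCalibration` (which did the same for the aside crux 16737):

* `integralMultipleTwoAdicWith_of_ceUltTwoAdicWith` — **`CEUltTwoAdicWith b → IntegralMultipleTwoAdicWith (b+2)`**:
  the stub is NECESSARY for the crux (`JetConstantElimTwoAdic ↔ ∃ b, CEUltTwoAdicWith b`, tree
  `jetConstantElimTwoAdic_iff`); with the tree's converse `ceUltTwoAdic_of_integralMultipleTwoAdic`
  the one open stub of 23655 is EQUIVALENT to the crux.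
* `integralMultipleTwoAdicWith_of_uniformIntegralJetsTwoAdic`,
  `cheapMultiplesTwoAdic_of_uniformIntegralJetsTwoAdic`, `not_cfUlt_of_cheapMultiplesTwoAdic`,
  `not_cfUlt_of_uniformIntegralJetsTwoAdic` — THE `Q`-FREE ROAD IS CLOSED, sharper than for 16737:
  uniform bounded-height integer circuits for multiples of 2-adic depth `≤ (n+2)^c` of the jets
  (the only circuit-insensitive source of the stub) refute the partner binder
  `CF^ult = ∀ c ∃ k ≥ 1, CFUltAt c k` (stmt-23656) OUTRIGHT — no multiplier removal is involved,
  because `CF^ult` is itself multiplier-robust. So a proof of the stub the route can use must read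
  the near-optimal `ℚ̄`-circuit it is given.

Honest framing: calibration of an open, conjecture-grade stub; VP ≠ VNP is NOT proved here.
-/

noncomputable section

-- single-conjunct layout: Sub = Summit, duplicated namespace component intended
set_option linter.dupNamespace false

namespace Summit.ValiantsHypothesis.ValiantsHypothesis.Theorems.AnyonJets.JetConstantElim

open MvPolynomial Literature.Computability.AlgebraicComplexity
open Literature.Computability.AlgebraicComplexity.ArithCircuit
open Summit.ValiantsHypothesis.ValiantsHypothesis.Theorems.AnyonJets.ConstantFreeJetGrowth (jet)
open scoped BigOperators

/-! ### The stub is necessary for the crux -/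

/-- **`CEUltTwoAdicWith b → IntegralMultipleTwoAdicWith (b + 2)`**: a multiple `M·J` of 2-adic
depth and constant-free complexity `≤ (L_ℂ(J) + n + 2)^b` gives, for every `ℚ̄`-circuit `Q` for
`J` (so `L_ℂ(J) ≤ size Q` by base change along `ℚ̄ → ℂ`), a sign-constant integer circuit `P`
(`t = 0`) for `M·J` with `size P + 2 ≤ X^b + X ≤ X^(b+2)`, `X = size Q + n + 2`. [folklore] -/
theorem integralMultipleTwoAdicWith_of_ceUltTwoAdicWith (b : ℕ) (hCE : CEUltTwoAdicWith b) :
    IntegralMultipleTwoAdicWith (b + 2) := by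
  intro n k hk Q hQ2 hQc
  -- `L_ℂ(J) ≤ size Q`
  have hL : complexity (MvPolynomial.map (Int.castRingHom ℂ) (jet n k)) ≤ Q.size := by
    haveI : Algebra.IsAlgebraic ℚ (AlgebraicClosure ℚ) := AlgebraicClosure.isAlgebraic ℚ
    let ι : AlgebraicClosure ℚ →ₐ[ℚ] ℂ :=
      IsAlgClosed.lift (R := ℚ) (S := AlgebraicClosure ℚ) (M := ℂ)
    have hmap : MvPolynomial.map (ι : AlgebraicClosure ℚ →+* ℂ)
        (MvPolynomial.map (Int.castRingHom (AlgebraicClosure ℚ)) (jet n k)) =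
        MvPolynomial.map (Int.castRingHom ℂ) (jet n k) := by
      rw [MvPolynomial.map_map]
      exact congrArg (fun φ : ℤ →+* ℂ => MvPolynomial.map φ (jet n k)) (RingHom.ext_int _ _)
    have hQ := hQc.map (ι : AlgebraicClosure ℚ →+* ℂ)
    rw [hmap] at hQ
    simpa [size_map] using complexity_le_size (hQ2.map _) hQ
  obtain ⟨M, hM1, hv, hτ⟩ := hCE n k hk
  obtain ⟨P, hP2, hPs, hPc, hPsize⟩ := exists_computes_size_eq_constantFreeComplexity ((M : ℤ) • jet n k)
  -- height `2^0`
  have hsgn : ∀ c : ℤ, IsSignConstant c → c.natAbs ≤ 2 ^ 0 := by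
    rintro c (hc0 | hc0 | hc0)
    · subst hc0; simp
    · subst hc0; simp
    · obtain rfl : c = -1 := by omega
      simp
  have hheight : (∀ g ∈ P.gates, ∀ u ∈ g.args, ∀ c : ℤ, u = .const c → c.natAbs ≤ 2 ^ 0) ∧
      (∀ args : List (ℤ × Operand ℤ (Fin n × Fin n)), Gate.sum args ∈ P.gates →
        ∀ a ∈ args, a.1.natAbs ≤ 2 ^ 0) ∧
      (∀ c : ℤ, P.output = .const c → c.natAbs ≤ 2 ^ 0) := by
    obtain ⟨hg, ho⟩ := hPs
    refine ⟨?_, fun args hargs a ha => hsgn _ ((hg _ hargs) a ha).1, fun c hcO => hsgn _ (by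
      rw [hcO] at ho; exact ho)⟩
    intro g hgP u hu c huc
    subst huc
    have hgs := hg g hgP
    cases g with
    | sum args =>
      simp only [Gate.args, List.mem_map] at hu
      obtain ⟨a, ha, hau⟩ := hu
      have hh := (hgs a ha).2
      rw [hau] at hh
      exact hsgn _ hh
    | prod args => exact hsgn _ (hgs _ hu)
  set X := Q.size + n + 2 with hX
  have hX2 : 2 ≤ X := by omega
  have hLX : complexity (MvPolynomial.map (Int.castRingHom ℂ) (jet n k)) + n + 2 ≤ X := by omega
  have hpow : (complexity (MvPolynomial.map (Int.castRingHom ℂ) (jet n k)) + n + 2) ^ b ≤ X ^ b :=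
    Nat.pow_le_pow_left hLX _
  have hgrow : X ^ b + X ≤ X ^ (b + 2) := by
    have h1 : X ≤ X ^ (b + 1) := by
      calc X = X ^ 1 := (pow_one X).symm
        _ ≤ X ^ (b + 1) := Nat.pow_le_pow_right (by omega) (by omega)
    have h2 : X ^ b ≤ X ^ (b + 1) := Nat.pow_le_pow_right (by omega) (by omega)
    calc X ^ b + X ≤ X ^ (b + 1) + X ^ (b + 1) := add_le_add h2 h1
      _ = 2 * X ^ (b + 1) := by ring
      _ ≤ X * X ^ (b + 1) := Nat.mul_le_mul_right _ hX2
      _ = X ^ (b + 2) := by ring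
  refine ⟨P, 0, M, hM1, hP2, hPc, hheight, ?_, ?_⟩
  · have : P.size ≤ X ^ b := hPsize ▸ hτ.trans hpow
    omega
  · exact hv.trans (hpow.trans ((Nat.le_add_right _ _).trans hgrow))

/-! ### The `Q`-free road is closed: it refutes the partner binder `CF^ult` -/

/-- Uniform bounded-height integer circuits for 2-adically shallow multiples of the jets give the
stub for free (ignoring `Q`). [folklore] -/
theorem integralMultipleTwoAdicWith_of_uniformIntegralJetsTwoAdic (c : ℕ)
    (hU : ∀ n k : ℕ, k ≤ Nat.log 2 n → ∃ (P : ArithCircuit ℤ (Fin n × Fin n)) (t M : ℕ),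
        1 ≤ M ∧ P.IsFanInTwo ∧ P.Computes ((M : ℤ) • jet n k) ∧
        ((∀ g ∈ P.gates, ∀ u ∈ g.args, ∀ c : ℤ, u = .const c → c.natAbs ≤ 2 ^ t) ∧
          (∀ args : List (ℤ × Operand ℤ (Fin n × Fin n)), Gate.sum args ∈ P.gates →
            ∀ a ∈ args, a.1.natAbs ≤ 2 ^ t) ∧
          (∀ c : ℤ, P.output = .const c → c.natAbs ≤ 2 ^ t)) ∧
        P.size + t + 2 ≤ (n + 2) ^ c ∧ padicValNat 2 M ≤ (n + 2) ^ c) :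
    IntegralMultipleTwoAdicWith c := by
  intro n k hk Q _ _
  obtain ⟨P, t, M, hM, hP2, hPc, hPb, hPs, hv⟩ := hU n k hk
  exact ⟨P, t, M, hM, hP2, hPc, hPb, hPs.trans (Nat.pow_le_pow_left (by omega) _),
    hv.trans (Nat.pow_le_pow_left (by omega) _)⟩

/-- … and they are uniformly cheap 2-adically shallow multiples (`stub_signSimulation`, PROVED).
[cite: Burgisser2000, §1.4] -/
theorem cheapMultiplesTwoAdic_of_uniformIntegralJetsTwoAdic (c : ℕ)
    (hU : ∀ n k : ℕ, k ≤ Nat.log 2 n → ∃ (P : ArithCircuit ℤ (Fin n × Fin n)) (t M : ℕ),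
        1 ≤ M ∧ P.IsFanInTwo ∧ P.Computes ((M : ℤ) • jet n k) ∧
        ((∀ g ∈ P.gates, ∀ u ∈ g.args, ∀ c : ℤ, u = .const c → c.natAbs ≤ 2 ^ t) ∧
          (∀ args : List (ℤ × Operand ℤ (Fin n × Fin n)), Gate.sum args ∈ P.gates →
            ∀ a ∈ args, a.1.natAbs ≤ 2 ^ t) ∧
          (∀ c : ℤ, P.output = .const c → c.natAbs ≤ 2 ^ t)) ∧
        P.size + t + 2 ≤ (n + 2) ^ c ∧ padicValNat 2 M ≤ (n + 2) ^ c) :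
    ∃ c' : ℕ, ∀ n k : ℕ, k ≤ Nat.log 2 n → ∃ M : ℕ, 1 ≤ M ∧ padicValNat 2 M ≤ (n + 2) ^ c' ∧
      constantFreeComplexity ((M : ℤ) • jet n k) ≤ (n + 2) ^ c' := by
  obtain ⟨b₂, hb₂⟩ := stub_signSimulation
  refine ⟨c * (b₂ + 1), fun n k hk => ?_⟩
  obtain ⟨P, t, M, hM, hP2, hPc, hPb, hPs, hv⟩ := hU n k hk
  have hone : 1 ≤ (n + 2) ^ c := Nat.one_le_pow _ _ (by omega)
  refine ⟨M, hM, hv.trans ?_, ?_⟩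
  · calc (n + 2) ^ c = ((n + 2) ^ c) ^ 1 := (pow_one _).symm
      _ ≤ ((n + 2) ^ c) ^ (b₂ + 1) := Nat.pow_le_pow_right hone (by omega)
      _ = (n + 2) ^ (c * (b₂ + 1)) := by rw [← pow_mul]
  · calc constantFreeComplexity ((M : ℤ) • jet n k) ≤ (P.size + t + 2) ^ b₂ :=
          hb₂ (Fin n × Fin n) _ P t hP2 hPc hPb
      _ ≤ ((n + 2) ^ c) ^ b₂ := Nat.pow_le_pow_left hPs _
      _ ≤ ((n + 2) ^ c) ^ (b₂ + 1) := Nat.pow_le_pow_right hone (by omega)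
      _ = (n + 2) ^ (c * (b₂ + 1)) := by rw [← pow_mul]

/-- **Cheap 2-adically shallow multiples refute `CF^ult`** (at `c' = 2c + 1`, for the `k ≥ 1` it
provides and `n ≥ max (2^k) 2`: `n^(2c+1) ≤ τ(M·J) ≤ (n+2)^c ≤ n^(2c)`). [folklore] -/
theorem not_cfUlt_of_cheapMultiplesTwoAdic
    (hC : ∃ c : ℕ, ∀ n k : ℕ, k ≤ Nat.log 2 n → ∃ M : ℕ, 1 ≤ M ∧ padicValNat 2 M ≤ (n + 2) ^ c ∧
      constantFreeComplexity ((M : ℤ) • jet n k) ≤ (n + 2) ^ c) :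
    ¬ (∀ c : ℕ, ∃ k : ℕ, 1 ≤ k ∧ CFUltAt c k) := by
  intro hCF
  obtain ⟨c, hc⟩ := hC
  obtain ⟨k, -, hk⟩ := hCF (2 * c + 1)
  obtain ⟨n, hn, hM⟩ := hk (max (2 ^ k) 2)
  have h2k : 2 ^ k ≤ n := le_trans (le_max_left _ _) hn
  have hn2 : 2 ≤ n := le_trans (le_max_right _ _) hn
  have hklog : k ≤ Nat.log 2 n := Nat.le_log_of_pow_le (by norm_num) h2k
  obtain ⟨M, hM1, hv, hτ⟩ := hc n k hklog
  have hsq : (n + 2) ^ c ≤ n ^ (2 * c) := by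
    calc (n + 2) ^ c ≤ (n ^ 2) ^ c := Nat.pow_le_pow_left (by nlinarith) _
      _ = n ^ (2 * c) := by rw [← pow_mul]
  have hlt : n ^ (2 * c) < n ^ (2 * c + 1) := Nat.pow_lt_pow_right (by omega) (by omega)
  have h1 : n ^ (2 * c + 1) ≤ (n + 2) ^ c := (hM M hM1 (by omega)).trans hτ
  omega

/-- **The `Q`-free road to the stub of 23655 refutes the partner binder `CF^ult` (stmt-23656)**:
no multiplier removal is needed, `CF^ult` being multiplier-robust. Hence any proof of
`∃ b₁, IntegralMultipleTwoAdicWith b₁` the route can use must read the near-optimal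
`ℚ̄`-circuit it is given. [folklore] -/
theorem not_cfUlt_of_uniformIntegralJetsTwoAdic (c : ℕ)
    (hU : ∀ n k : ℕ, k ≤ Nat.log 2 n → ∃ (P : ArithCircuit ℤ (Fin n × Fin n)) (t M : ℕ),
        1 ≤ M ∧ P.IsFanInTwo ∧ P.Computes ((M : ℤ) • jet n k) ∧
        ((∀ g ∈ P.gates, ∀ u ∈ g.args, ∀ c : ℤ, u = .const c → c.natAbs ≤ 2 ^ t) ∧
          (∀ args : List (ℤ × Operand ℤ (Fin n × Fin n)), Gate.sum args ∈ P.gates →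
            ∀ a ∈ args, a.1.natAbs ≤ 2 ^ t) ∧
          (∀ c : ℤ, P.output = .const c → c.natAbs ≤ 2 ^ t)) ∧
        P.size + t + 2 ≤ (n + 2) ^ c ∧ padicValNat 2 M ≤ (n + 2) ^ c) :
    ¬ (∀ c : ℕ, ∃ k : ℕ, 1 ≤ k ∧ CFUltAt c k) :=
  not_cfUlt_of_cheapMultiplesTwoAdic (cheapMultiplesTwoAdic_of_uniformIntegralJetsTwoAdic c hU)

end Summit.ValiantsHypothesis.ValiantsHypothesis.Theorems.AnyonJets.JetConstantElim

end
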